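import Literature.AlgebraicGeometry.Limits.GenericFibreSpread
import Literature.AlgebraicGeometry.Resolution.MarkedIdealsEtale
import Mathlib.RingTheory.Spectrum.Prime.Chevalley
import Mathlib.RingTheory.Localization.FractionRing
import Mathlib.RingTheory.Localization.Ideal
import Mathlib.RingTheory.Localization.Away.Basic
import Mathlib.RingTheory.Flat.Basic
import Mathlib.RingTheory.TensorProduct.Quotient
import Mathlib.RingTheory.FinitePresentation
import Mathlib.RingTheory.Ideal.Colon
import Mathlib.RingTheory.Nilpotent.Lemmas
import HarnessLib

/-!
# Spreading out from the generic point: the commutative algebra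

Topic: `Literature/AlgebraicGeometry/Resolution`. Elementary lemmas of the "spreading out"
technique (EGA IV₃ §8 / §9 in spirit, here in the naive form that suffices for resolution of
singularities in large characteristic, `EffectiveResolution.lean`,
`EffectiveResolutionSpread.lean`): a Noetherian domain `A` with fraction field `K` (the generic
point `η` of `Spec A`), an `A`-algebra `B` of finite type (a family over `Spec A`), and the fibres
`B ⊗_A k` at field-valued points `A → k`. Everything is PROVED:

* `exists_forall_prime_notMem_of_generic` — **Chevalley at the generic point**: if `t ∈ B` lies
  outside some prime of `B` over `η`, then for all primes `𝔭 ∌ a` of `A` (some `a ≠ 0`) `t` lies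
  outside some prime of `B` over `𝔭` (the image of `D(t)` is constructible, Mathlib's
  `PrimeSpectrum.isConstructible_comap_image`, and a constructible set through the generic
  point contains a basic open, `Literature.AlgebraicGeometry.Limits.GenericFibreSpread`);
* `not_isNilpotent_tmul_one` — if `t` lies outside a prime of `B` over the kernel of `A → k`
  (`k` a field), then `t ⊗ 1` is not nilpotent in `B ⊗_A k`; whence
  `exists_forall_not_isNilpotent_tmul_one` (non-vanishing of `t` on the fibres over a
  neighbourhood of `η`) and `exists_forall_not_isDomain_tensor` (if `t₁ t₂` is nilpotent but
  `t₁`, `t₂` are not nilpotent at `η`, the fibres over a neighbourhood of `η` are not integral);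
* `tensor_quotient_bijective_of_isReduced` — an ideal `J ⊆ B` which is nil modulo `A`-torsion
  dies in every REDUCED fibre over a neighbourhood of `η`: `B ⊗_A k → (B ⧸ J) ⊗_A k` is bijective;
* `satPowers N u = ⋃ₙ (N : uⁿ)` (the `u`-saturation, i.e. the contraction of `N B[1/u]`)
  and **its compatibility with flat base change** `map_satPowers_of_flat` (through
  `map_colon_singleton_of_flat : (N : x) B' = (N B' : x)` for `B → B'` flat, from Mathlib's
  `Module.Flat.ker_lTensor_eq`).

## Sources

* A. Grothendieck, EGA IV₃, §8 (limites projectives), §9.2–9.7 (propriétés constructibles);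
  The Stacks Project, Tag 00FE (Chevalley), Tag 051R (generic flatness, not needed here).
  [folklore]
* H. Matsumura, *Commutative Ring Theory* (1987), Thm. 7.4 (iii). [Matsumura1987]
-/

noncomputable section

open TensorProduct

namespace Literature.AlgebraicGeometry.Resolution

/-! ## Chevalley at the generic point -/

section Chevalley

variable {A : Type*} [CommRing A] [IsDomain A] [IsNoetherianRing A]
variable {B : Type*} [CommRing B] [Algebra A B] [Algebra.FiniteType A B]

/-- **Chevalley's theorem at the generic point.** Let `B` be an algebra of finite type over the
Noetherian domain `A` and `t ∈ B`. If `t` lies outside some prime `P` of `B` lying over the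
generic point of `Spec A` (`P ∩ A = 0`), then there is `a ≠ 0` in `A` such that for every prime
`𝔭 ∌ a` of `A`, `t` lies outside some prime of `B` lying over `𝔭`: the image of the open `D(t)`
in `Spec A` is constructible (Chevalley) and contains the generic point, hence a basic open.
[folklore] -/
theorem exists_forall_prime_notMem_of_generic (t : B)
    (h : ∃ P : Ideal B, P.IsPrime ∧ t ∉ P ∧ P.comap (algebraMap A B) = ⊥) :
    ∃ a : A, a ≠ 0 ∧ ∀ 𝔭 : Ideal A, 𝔭.IsPrime → a ∉ 𝔭 →
      ∃ P : Ideal B, P.IsPrime ∧ t ∉ P ∧ P.comap (algebraMap A B) = 𝔭 := by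
  haveI : Algebra.FinitePresentation A B :=
    Algebra.FinitePresentation.of_finiteType.mp inferInstance
  have hfp : (algebraMap A B).FinitePresentation :=
    RingHom.finitePresentation_algebraMap.mpr inferInstance
  set s : Set (PrimeSpectrum A) :=
    PrimeSpectrum.comap (algebraMap A B) '' (PrimeSpectrum.basicOpen t : Set (PrimeSpectrum B))
  have hs : Topology.IsConstructible s :=
    PrimeSpectrum.isConstructible_comap_image hfp
      ((PrimeSpectrum.isCompact_basicOpen t).isConstructible PrimeSpectrum.isOpen_basicOpen)
  have hη : (⊥ : PrimeSpectrum A) ∈ s := by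
    obtain ⟨P, hP, htP, hPA⟩ := h
    refine ⟨⟨P, hP⟩, htP, ?_⟩
    ext1
    rw [PrimeSpectrum.comap_asIdeal, PrimeSpectrum.asIdeal_bot]
    exact hPA
  obtain ⟨a, ha0, has⟩ :=
    Literature.AlgebraicGeometry.Limits.exists_basicOpen_subset_of_isConstructible hs hη
  refine ⟨a, ha0, fun 𝔭 h𝔭 ha𝔭 => ?_⟩
  obtain ⟨⟨P, hP⟩, htP, hP𝔭⟩ := has (show (⟨𝔭, h𝔭⟩ : PrimeSpectrum A) ∈ _ from ha𝔭)
  exact ⟨P, hP, htP, congrArg PrimeSpectrum.asIdeal hP𝔭⟩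

end Chevalley

/-! ## Non-vanishing on the fibres -/

section Fibres

variable {A : Type*} [CommRing A] {B : Type*} [CommRing B] [Algebra A B]
variable {k : Type*} [Field k] [Algebra A k]

/-- **If `t ∈ B` lies outside a prime `P` of `B` lying over the kernel `𝔭` of `A → k` (`k` a
field), then `t ⊗ 1` is not nilpotent in the fibre ring `B ⊗_A k`.** Proof: with `D = A/𝔭 ⊆ k`,
`E = B/P ⊇ D` and `κ = Frac D`, the ring `Frac(E) ⊗_κ k` receives compatible maps from `B` and
`k`, hence a ring map from `B ⊗_A k` sending `t ⊗ 1` to `t̄ ⊗ 1`, which is not nilpotent because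
`Frac(E) → Frac(E) ⊗_κ k` is injective (`k` is flat over the field `κ`) and `t̄ ≠ 0` in the
field `Frac(E)`. [folklore] -/
theorem not_isNilpotent_tmul_one {P : Ideal B} [hP : P.IsPrime] {t : B} (ht : t ∉ P)
    (hPA : P.comap (algebraMap A B) = RingHom.ker (algebraMap A k)) :
    ¬ IsNilpotent (t ⊗ₜ[A] (1 : k) : B ⊗[A] k) := by
  classical
  -- the domains `D = A/𝔭 ⊆ E = B/P` and their fraction fields
  set 𝔭 : Ideal A := RingHom.ker (algebraMap A k) with h𝔭
  let D := A ⧸ 𝔭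
  let E := B ⧸ P
  haveI : IsDomain E := Ideal.Quotient.isDomain P
  haveI : 𝔭.IsPrime := RingHom.ker_isPrime _
  haveI : IsDomain D := Ideal.Quotient.isDomain 𝔭
  -- `D → E`
  let iDE : D →+* E := Ideal.quotientMap P (algebraMap A B) (by rw [← hPA])
  have hiDE : Function.Injective iDE :=
    Ideal.quotientMap_injective' (le_of_eq hPA)
  -- `D → k`
  let iDk : D →+* k := RingHom.kerLift (algebraMap A k)
  have hiDk : Function.Injective iDk := RingHom.kerLift_injective _
  -- fraction fields
  let κ := FractionRing D
  let F := FractionRing E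
  have hDF : Function.Injective ((algebraMap E F).comp iDE) :=
    (IsFractionRing.injective E F).comp hiDE
  let jκF : κ →+* F := IsFractionRing.lift hDF
  let jκk : κ →+* k := IsFractionRing.lift hiDk
  letI : Algebra κ F := jκF.toAlgebra
  letI : Algebra κ k := jκk.toAlgebra
  -- the target ring `T = F ⊗_κ k` (an `A`-algebra through `A → B → E → F`)
  haveI : Module.Free κ F := Module.Free.of_divisionRing κ F
  haveI : Module.Flat κ F := Module.Flat.of_free
  let T := F ⊗[κ] k
  -- `algebraMap A F` factors through `B → E`
  have hAF : ∀ a : A, algebraMap A F a = algebraMap E F (Ideal.Quotient.mk P (algebraMap A B a)) := by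
    intro a
    rw [IsScalarTower.algebraMap_apply A E F, IsScalarTower.algebraMap_apply A B E]
    rfl
  -- compatibility over `A` of the two inclusions
  have hcomp : ∀ a : A, (algebraMap A F a) ⊗ₜ[κ] (1 : k) = (1 : F) ⊗ₜ[κ] (algebraMap A k a) := by
    intro a
    have h1 : algebraMap A F a = jκF (algebraMap D κ (Ideal.Quotient.mk 𝔭 a)) := by
      rw [hAF, IsFractionRing.lift_algebraMap]
      rfl
    have h2 : algebraMap A k a = jκk (algebraMap D κ (Ideal.Quotient.mk 𝔭 a)) := by
      rw [IsFractionRing.lift_algebraMap]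
      rfl
    rw [h1, h2]
    set c : κ := algebraMap D κ (Ideal.Quotient.mk 𝔭 a)
    change (algebraMap κ F c) ⊗ₜ[κ] (1 : k) = (1 : F) ⊗ₜ[κ] (algebraMap κ k c)
    rw [Algebra.algebraMap_eq_smul_one (A := F) c, Algebra.algebraMap_eq_smul_one (A := k) c,
      smul_tmul]
  -- the induced map `Ψ : B ⊗_A k → T`
  let fB : B →ₐ[A] T :=
    (Algebra.TensorProduct.includeLeft (R := κ) (S := A) (A := F) (B := k)).comp
      ((IsScalarTower.toAlgHom A E F).comp (Ideal.Quotient.mkₐ A P))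
  let fk : k →ₐ[A] T :=
    ⟨(Algebra.TensorProduct.includeRight (R := κ) (A := F) (B := k)).toRingHom, fun a => by
      change (1 : F) ⊗ₜ[κ] (algebraMap A k a) = algebraMap A T a
      rw [Algebra.TensorProduct.algebraMap_apply, hcomp]⟩
  let Ψ : B ⊗[A] k →ₐ[A] T := Algebra.TensorProduct.lift fB fk fun x y => Commute.all _ _
  have hΨ : Ψ (t ⊗ₜ[A] (1 : k)) = (algebraMap E F (Ideal.Quotient.mk P t)) ⊗ₜ[κ] (1 : k) := by
    simp only [Ψ, Algebra.TensorProduct.lift_tmul, map_one, mul_one]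
    rfl
  -- if `t ⊗ 1` were nilpotent, so would be `t̄ ⊗ 1 = includeLeft t̄`, hence `t̄ = 0`
  intro hnil
  have hnil' : IsNilpotent ((algebraMap E F (Ideal.Quotient.mk P t)) ⊗ₜ[κ] (1 : k) : T) :=
    hΨ ▸ hnil.map Ψ
  obtain ⟨m, hm⟩ := hnil'
  have hinj : Function.Injective
      (Algebra.TensorProduct.includeLeft (R := κ) (S := κ) (A := F) (B := k)) :=
    Algebra.TensorProduct.includeLeft_injective (algebraMap κ k).injective
  have hzero : (algebraMap E F (Ideal.Quotient.mk P t)) ^ m = 0 := by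
    apply hinj
    rw [map_pow, map_zero]
    exact hm
  have ht0 : Ideal.Quotient.mk P t = 0 :=
    (IsFractionRing.injective E F) (by rw [map_zero]; exact eq_zero_of_pow_eq_zero hzero)
  exact ht (Ideal.Quotient.eq_zero_iff_mem.mp ht0)

end Fibres

section FibresNoetherian

variable {A : Type*} [CommRing A] [IsDomain A] [IsNoetherianRing A]
variable {B : Type*} [CommRing B] [Algebra A B] [Algebra.FiniteType A B]

/-- **Non-vanishing on the fibres over a neighbourhood of the generic point.** If `t ∈ B` lies
outside some prime of `B` over the generic point of `Spec A`, then there is `a ≠ 0` in `A` such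
that `t ⊗ 1` is not nilpotent (in particular not zero) in the fibre `B ⊗_A k` at every
field-valued point `A → k` with `a ↦ a' ≠ 0`. [folklore] -/
theorem exists_forall_not_isNilpotent_tmul_one (t : B)
    (h : ∃ P : Ideal B, P.IsPrime ∧ t ∉ P ∧ P.comap (algebraMap A B) = ⊥) :
    ∃ a : A, a ≠ 0 ∧ ∀ (k : Type*) [Field k] [Algebra A k], algebraMap A k a ≠ 0 →
      ¬ IsNilpotent (t ⊗ₜ[A] (1 : k) : B ⊗[A] k) := by
  obtain ⟨a, ha0, ha⟩ := exists_forall_prime_notMem_of_generic t h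
  refine ⟨a, ha0, fun k _ _ hak => ?_⟩
  haveI : (RingHom.ker (algebraMap A k)).IsPrime := RingHom.ker_isPrime _
  obtain ⟨P, hP, htP, hPA⟩ := ha (RingHom.ker (algebraMap A k)) inferInstance
    (by rwa [RingHom.mem_ker])
  haveI := hP
  exact not_isNilpotent_tmul_one htP hPA

/-- **Reducibility spreads to the fibres.** If `t₁ t₂` is nilpotent in `B` while `t₁` and `t₂`
each lie outside some prime of `B` over the generic point of `Spec A` (so that the generic fibre
is not irreducible, or not reduced along two "branches"), then there is `a ≠ 0` such that no
fibre `B ⊗_A k` at a field-valued point of `D(a)` is an integral domain. [folklore] -/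
theorem exists_forall_not_isDomain_tensor (t₁ t₂ : B) (h12 : IsNilpotent (t₁ * t₂))
    (h₁ : ∃ P : Ideal B, P.IsPrime ∧ t₁ ∉ P ∧ P.comap (algebraMap A B) = ⊥)
    (h₂ : ∃ P : Ideal B, P.IsPrime ∧ t₂ ∉ P ∧ P.comap (algebraMap A B) = ⊥) :
    ∃ a : A, a ≠ 0 ∧ ∀ (k : Type*) [Field k] [Algebra A k], algebraMap A k a ≠ 0 →
      ¬ IsDomain (B ⊗[A] k) := by
  obtain ⟨a₁, ha₁, h₁'⟩ := exists_forall_not_isNilpotent_tmul_one t₁ h₁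
  obtain ⟨a₂, ha₂, h₂'⟩ := exists_forall_not_isNilpotent_tmul_one t₂ h₂
  refine ⟨a₁ * a₂, mul_ne_zero ha₁ ha₂, fun k _ _ hak hdom => ?_⟩
  rw [map_mul] at hak
  have hn₁ := h₁' k (left_ne_zero_of_mul hak)
  have hn₂ := h₂' k (right_ne_zero_of_mul hak)
  have hprod : IsNilpotent ((t₁ ⊗ₜ[A] (1 : k)) * (t₂ ⊗ₜ[A] (1 : k)) : B ⊗[A] k) := by
    rw [Algebra.TensorProduct.tmul_mul_tmul, mul_one]
    exact h12.map (Algebra.TensorProduct.includeLeft (R := A) (S := A) (A := B) (B := k))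
  haveI := hdom
  rcases mul_eq_zero.mp hprod.eq_zero with h0 | h0
  · exact hn₁ (h0 ▸ IsNilpotent.zero)
  · exact hn₂ (h0 ▸ IsNilpotent.zero)

end FibresNoetherian

/-! ## Ideals which are nil modulo torsion die in the reduced fibres -/

section NilModTorsion

variable {A : Type*} [CommRing A] {B : Type*} [CommRing B] [Algebra A B]

/-- If `a • g ^ m = 0` with `a` invertible in the field `k`, then `g ⊗ 1` is nilpotent in
`B ⊗_A k`. [folklore] -/
theorem isNilpotent_tmul_one_of_smul_pow_eq_zero {k : Type*} [Field k] [Algebra A k]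
    {g : B} {m : ℕ} {a : A} (h : a • g ^ m = 0) (ha : algebraMap A k a ≠ 0) :
    IsNilpotent (g ⊗ₜ[A] (1 : k) : B ⊗[A] k) := by
  refine ⟨m, ?_⟩
  have e : (g ⊗ₜ[A] (1 : k) : B ⊗[A] k) ^ m = (g ^ m) ⊗ₜ[A] (1 : k) := by
    rw [Algebra.TensorProduct.tmul_pow, one_pow]
  rw [e]
  have h2 : (g ^ m) ⊗ₜ[A] (algebraMap A k a) = 0 := by
    rw [Algebra.algebraMap_eq_smul_one, ← smul_tmul, h, zero_tmul]
  have h3 : (g ^ m) ⊗ₜ[A] (1 : k) =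
      ((1 : B) ⊗ₜ[A] (algebraMap A k a)⁻¹) * ((g ^ m) ⊗ₜ[A] (algebraMap A k a)) := by
    rw [Algebra.TensorProduct.tmul_mul_tmul, one_mul, inv_mul_cancel₀ ha]
  rw [h3, h2, mul_zero]

/-- **An ideal which is nil modulo `A`-torsion dies in the reduced fibres.** Let `J = (S) ⊆ B`
be generated by finitely many elements `g` each satisfying `a • g ^ m = 0` for some `m` and some
`a ≠ 0` in `A`. Then there is `a ≠ 0` such that for every field-valued point `A → k` with
`a ↦ a' ≠ 0` at which the fibre `B ⊗_A k` is reduced, the surjection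
`B ⊗_A k → (B ⧸ J) ⊗_A k` is bijective (its kernel is generated by the nilpotents `g ⊗ 1`).
[folklore] -/
theorem tensor_quotient_bijective_of_isReduced [IsDomain A] (S : Finset B) {J : Ideal B}
    (hS : Ideal.span (S : Set B) = J) (hnil : ∀ g ∈ S, ∃ (m : ℕ) (a : A), a ≠ 0 ∧ a • g ^ m = 0) :
    ∃ a : A, a ≠ 0 ∧ ∀ (k : Type*) [Field k] [Algebra A k], algebraMap A k a ≠ 0 →
      IsReduced (B ⊗[A] k) →
      Function.Bijective (Algebra.TensorProduct.map (Ideal.Quotient.mkₐ A J) (AlgHom.id A k)) := by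
  classical
  choose m a ha0 ha using fun g : S => hnil g g.2
  refine ⟨∏ g : S, a g, Finset.prod_ne_zero_iff.mpr fun g _ => ha0 g, fun k _ _ hak hred => ?_⟩
  rw [map_prod] at hak
  have hak' : ∀ g : S, algebraMap A k (a g) ≠ 0 := fun g =>
    Finset.prod_ne_zero_iff.mp hak g (Finset.mem_univ g)
  set f := Algebra.TensorProduct.map (Ideal.Quotient.mkₐ A J) (AlgHom.id A k) with hf
  have hsurj : Function.Surjective f :=
    Algebra.TensorProduct.map_surjective _ _ Ideal.Quotient.mk_surjective Function.surjective_id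
  refine ⟨?_, hsurj⟩
  -- the kernel is generated by the `g ⊗ 1`, `g ∈ S`, which are nilpotent
  have hker : RingHom.ker f =
      Ideal.map (Algebra.TensorProduct.includeLeft : B →ₐ[A] B ⊗[A] k) J := by
    have hk : RingHom.ker (Ideal.Quotient.mkₐ A J) = J := by
      ext b
      rw [RingHom.mem_ker]
      exact Ideal.Quotient.eq_zero_iff_mem
    rw [hf, Algebra.TensorProduct.rTensor_ker _ Ideal.Quotient.mk_surjective, hk]
  have hle : RingHom.ker f ≤ nilradical (B ⊗[A] k) := by
    rw [hker, ← hS, Ideal.map_span, Ideal.span_le]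
    rintro _ ⟨g, hg, rfl⟩
    rw [SetLike.mem_coe, mem_nilradical]
    exact isNilpotent_tmul_one_of_smul_pow_eq_zero (ha ⟨g, hg⟩) (hak' ⟨g, hg⟩)
  rw [injective_iff_map_eq_zero]
  intro x hx
  have hx' : x ∈ RingHom.ker f := hx
  haveI := hred
  exact (mem_nilradical.mp (hle hx')).eq_zero

end NilModTorsion

/-! ## Saturation with respect to an element and flat base change -/

section Saturation

variable {B : Type*} [CommRing B]

/-- **`(N : x) B' = (N B' : x)` for a flat ring map `B → B'`** (Matsumura, Thm. 7.4 (iii),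
principal case): the non-formal inclusion is `Ideal.colon_singleton_map_le_of_flat` of
`MarkedIdealsEtale.lean` (kernel of `B → B ⧸ N`, `b ↦ x b`, tensored with the flat `B'`); the
other inclusion is formal. [cite: Matsumura1987, Thm. 7.4 (iii)] -/
theorem map_colon_singleton_of_flat (N : Ideal B) (x : B) (B' : Type*) [CommRing B']
    [Algebra B B'] [Module.Flat B B'] :
    (N.colon {x}).map (algebraMap B B') =
      (N.map (algebraMap B B')).colon {algebraMap B B' x} := by
  refine le_antisymm ?_ (Ideal.colon_singleton_map_le_of_flat N x)
  rw [Ideal.map_le_iff_le_comap]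
  intro b hb
  rw [Ideal.mem_comap, Submodule.mem_colon_singleton, smul_eq_mul, ← map_mul]
  exact Ideal.mem_map_of_mem _ (by simpa [Submodule.mem_colon_singleton] using hb)

/-- **The saturation `⋃ₙ (N : uⁿ)` of an ideal `N` with respect to an element `u`**: the
contraction of `N B[1/u]` back to `B`. [folklore] -/
def satPowers (N : Ideal B) (u : B) : Ideal B :=
  ⨆ n : ℕ, N.colon {u ^ n}

/-- Membership in the saturation. [folklore] -/
theorem mem_satPowers_iff {N : Ideal B} {u b : B} :
    b ∈ satPowers N u ↔ ∃ n : ℕ, u ^ n * b ∈ N := by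
  unfold satPowers
  have hdir : Directed (· ≤ ·) fun n : ℕ => N.colon ({u ^ n} : Set B) := by
    refine Monotone.directed_le fun m n hmn b hb => ?_
    rw [Submodule.mem_colon_singleton, smul_eq_mul] at hb ⊢
    obtain ⟨c, rfl⟩ := Nat.exists_eq_add_of_le hmn
    rw [pow_add, ← mul_assoc]
    exact Ideal.mul_mem_right _ _ hb
  rw [Submodule.mem_iSup_of_directed _ hdir]
  simp only [Submodule.mem_colon_singleton, smul_eq_mul, mul_comm b]

/-- `N ⊆ sat_u(N)`. [folklore] -/
theorem le_satPowers (N : Ideal B) (u : B) : N ≤ satPowers N u := fun b hb =>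
  mem_satPowers_iff.mpr ⟨0, by simpa using hb⟩

/-- **The saturation is the contraction of the extension to `B[1/u]`** (any localization
`S` of `B` away from `u`). [folklore] -/
theorem satPowers_eq_comap_map (N : Ideal B) (u : B) (S : Type*) [CommRing S]
    [Algebra B S] [IsLocalization.Away u S] :
    satPowers N u = (N.map (algebraMap B S)).comap (algebraMap B S) := by
  ext b
  rw [mem_satPowers_iff, Ideal.mem_comap,
    IsLocalization.mem_map_algebraMap_iff (Submonoid.powers u) S]
  constructor
  · rintro ⟨n, hn⟩
    refine ⟨⟨⟨u ^ n * b, hn⟩, ⟨u ^ n, n, rfl⟩⟩, ?_⟩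
    simp only [map_mul, mul_comm]
  · rintro ⟨⟨⟨m, hm⟩, ⟨_, n, rfl⟩⟩, h⟩
    simp only at h
    -- `b uⁿ = m` in `S`, hence `uᵏ (b uⁿ - m) = 0` in `B`
    rw [← map_mul, IsLocalization.eq_iff_exists (Submonoid.powers u) S] at h
    obtain ⟨⟨_, k, rfl⟩, hk⟩ := h
    simp only at hk
    refine ⟨k + n, ?_⟩
    have : u ^ (k + n) * b = u ^ k * m := by
      rw [pow_add, mul_assoc, mul_comm (u ^ n) b]
      exact hk
    rw [this]
    exact Ideal.mul_mem_left _ _ hm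

/-- **Saturation commutes with flat base change**: `sat_u(N) B' = sat_{u}(N B')` for `B → B'`
flat. [folklore] -/
theorem map_satPowers_of_flat (N : Ideal B) (u : B) (B' : Type*) [CommRing B']
    [Algebra B B'] [Module.Flat B B'] :
    (satPowers N u).map (algebraMap B B') =
      satPowers (N.map (algebraMap B B')) (algebraMap B B' u) := by
  unfold satPowers
  rw [Ideal.map_iSup]
  congr 1
  funext n
  rw [map_colon_singleton_of_flat, map_pow]

end Saturation

end Literature.AlgebraicGeometry.Resolution

end
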